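import Literature.Analysis.Complex.LaurentExpansionEval
import Literature.RingTheory.PowerSeries.LaurentSeriesConstants
import Literature.NumberTheory.Transcendental.AxSchanuelUniv
import Literature.FieldTheory.TranscendenceDegree.AlgebraicDependenceBookkeeping
import HarnessLib

/-!
# Ax's theorem for two analytic germs: the exponential-algebraic alternative

For germs `ℓ₁, ℓ₂` analytic at `0 ∈ ℂ`, Ax's theorem (Ax 1971, Thm. 3; tree
`Literature.NumberTheory.Transcendental.Ax1971.add_rank_le_trdeg_of_field`, applied in the
differential field `(ℂ⸨X⸩, d/dX)` with constants `ℂ`) says: unless `ℓ₁, ℓ₂` are `ℤ`-linearly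
dependent modulo constants, `trdeg_ℂ ℂ(ℓ₁, ℓ₂, e^{ℓ₁}, e^{ℓ₂}) ≥ 3`. We record the
contrapositive in the form used on branches of algebraic curves
(`exists_int_rel_of_isAlgebraic_taylor`): if the four Taylor series `ℓ̂₁, ℓ̂₂, (e^{ℓ₁})^, (e^{ℓ₂})^`
are algebraic over a subalgebra `ℂ[b₁, b₂] ⊆ ℂ⸨X⸩` generated by at most two elements, then
`a ℓ₁ + b ℓ₂` is constant near `0` for some `(a, b) ∈ ℤ² ∖ 0`. The transcendence-degree
bookkeeping is done with Mathlib's matroid of algebraic independence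
(`AlgebraicIndependent.matroid`). Everything PROVED, no definition. [cite: Ax1971, Thm. 3]

## References

* J. Ax, *On Schanuel's conjectures*, Ann. of Math. 93 (1971), 252–268, Thm. 3 and Cor. 1.
-/

noncomputable section

open Complex Filter Topology Set PowerSeries HahnSeries LaurentSeries Cardinal
open scoped Nat

namespace Literature.NumberTheory.Transcendental

namespace AxTwoGerms

open Literature.NumberTheory.Transcendental.AndreCriterion (coeff_taylor constantCoeff_taylor
  taylor_congr taylor_add taylor_const_mul taylor_mul taylor_one taylor_pow)
open Literature.Analysis.Complex.FormalRoot (taylor_eq_zero_iff taylor_sub eventuallyEq_of_taylor_eq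
  taylor_polynomial taylor_pow_id)
open Literature.Analysis.Complex.LaurentGerm (derivative_taylor_exp)
open Literature.RingTheory.PowerSeries (exists_derivation_eq_derivative
  derivative_eq_zero_iff_mem_range_algebraMap)
open Literature.FieldTheory.TranscendenceDegree (trdeg_le_card_of_forall_isAlgebraic)

/-- The Taylor series of `f : ℂ → ℂ` at `0`, as a formal power series (local notation). -/
local notation3 "𝓣[" f "]" =>
  (PowerSeries.mk fun n => ((Nat.factorial n : ℂ)⁻¹ * iteratedDeriv n f 0) : PowerSeries ℂ)

/-- **`d/dX` as a derivation for the `ℂ`-ALGEBRA structure of `ℂ⸨X⸩`** (Mathlib's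
`Algebra ℂ ℂ⸨X⸩` comes through power series, `HahnSeries.powerSeriesAlgebra`, and its scalar
multiplication is not definitionally the coefficientwise one; Ax's theorem is stated for the
former). [folklore] -/
theorem exists_algDerivation_eq_derivative :
    ∃ D : @Derivation ℂ (LaurentSeries ℂ) (LaurentSeries ℂ) _ _ _ _ _ Algebra.toModule,
      ∀ f, D f = LaurentSeries.derivative ℂ f := by
  let L : @LinearMap ℂ ℂ _ _ (RingHom.id ℂ) (LaurentSeries ℂ) (LaurentSeries ℂ) _ _
      Algebra.toModule Algebra.toModule :=
    @LinearMap.mk ℂ ℂ _ _ (RingHom.id ℂ) (LaurentSeries ℂ) (LaurentSeries ℂ) _ _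
      Algebra.toModule Algebra.toModule
      ⟨fun f => LaurentSeries.derivative ℂ f, fun f g => map_add (LaurentSeries.derivative ℂ) f g⟩
      (fun c f => by
        dsimp only
        rw [RingHom.id_apply, Algebra.smul_def, Algebra.smul_def,
          Literature.RingTheory.PowerSeries.algebraMap_laurentSeries_apply,
          Literature.RingTheory.PowerSeries.derivative_mul,
          Literature.RingTheory.PowerSeries.derivative_C, zero_mul, zero_add])
  have hL : ∀ f, L f = LaurentSeries.derivative ℂ f := fun f => rfl
  let D : @Derivation ℂ (LaurentSeries ℂ) (LaurentSeries ℂ) _ _ _ _ _ Algebra.toModule :=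
    @Derivation.mk ℂ (LaurentSeries ℂ) (LaurentSeries ℂ) _ _ _ _ _ Algebra.toModule L
      (by rw [hL]; exact Literature.RingTheory.PowerSeries.derivative_one)
      (by
        intro a b
        rw [hL, hL, hL, Literature.RingTheory.PowerSeries.derivative_mul, smul_eq_mul, smul_eq_mul]
        ring)
  exact ⟨D, fun f => rfl⟩

/-- The Taylor series of the exponential of a germ is non-zero. [folklore] -/
theorem ofPowerSeries_taylor_exp_ne_zero (ℓ : ℂ → ℂ) :
    (HahnSeries.ofPowerSeries ℤ ℂ 𝓣[fun z => exp (ℓ z)] : LaurentSeries ℂ) ≠ 0 := by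
  intro h
  rw [map_eq_zero_iff _ ofPowerSeries_injective] at h
  have := congrArg PowerSeries.constantCoeff h
  rw [constantCoeff_taylor, map_zero] at this
  exact Complex.exp_ne_zero _ this

/-- The algebra map `ℂ → ℂ⸨X⸩` on power series: `algebraMap c = (C c : ℂ⟦X⟧)`. [folklore] -/
theorem algebraMap_eq_ofPowerSeries_C (c : ℂ) :
    algebraMap ℂ (LaurentSeries ℂ) c = HahnSeries.ofPowerSeries ℤ ℂ (PowerSeries.C c) := rfl

/-- Taylor series of a constant. [folklore] -/
theorem taylor_const (c : ℂ) : 𝓣[fun _ : ℂ => c] = PowerSeries.C c := by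
  have h := taylor_polynomial (Polynomial.C c)
  simp only [Polynomial.eval_C] at h
  rw [h, Polynomial.coe_C]

/-- **Ax's theorem for two analytic germs (exponential-algebraic alternative).** Let `ℓ₁, ℓ₂` be
analytic at `0` and suppose the Taylor series of `ℓ₁, ℓ₂, e^{ℓ₁}, e^{ℓ₂}`, viewed in `ℂ⸨X⸩`, are all
algebraic over a subalgebra `ℂ[s]` generated by a set `s` of at most two Laurent series. Then
some non-trivial integer combination `a ℓ₁ + b ℓ₂` is constant near `0`. (Ax 1971 Thm. 3 with
one derivation `d/dX` on `ℂ⸨X⸩`, whose constants are `ℂ`: independence modulo constants would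
give transcendence degree `≥ 2 + 1 = 3 > 2`.) [cite: Ax1971, Thm. 3] -/
theorem exists_int_rel_of_isAlgebraic_taylor {ℓ₁ ℓ₂ : ℂ → ℂ} (h₁ : AnalyticAt ℂ ℓ₁ 0)
    (h₂ : AnalyticAt ℂ ℓ₂ 0) (s : Finset (LaurentSeries ℂ)) (hs : s.card ≤ 2)
    (ha₁ : IsAlgebraic (Algebra.adjoin ℂ (s : Set (LaurentSeries ℂ)))
      (HahnSeries.ofPowerSeries ℤ ℂ 𝓣[ℓ₁] : LaurentSeries ℂ))
    (ha₂ : IsAlgebraic (Algebra.adjoin ℂ (s : Set (LaurentSeries ℂ)))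
      (HahnSeries.ofPowerSeries ℤ ℂ 𝓣[ℓ₂] : LaurentSeries ℂ))
    (ha₃ : IsAlgebraic (Algebra.adjoin ℂ (s : Set (LaurentSeries ℂ)))
      (HahnSeries.ofPowerSeries ℤ ℂ 𝓣[fun z => exp (ℓ₁ z)] : LaurentSeries ℂ))
    (ha₄ : IsAlgebraic (Algebra.adjoin ℂ (s : Set (LaurentSeries ℂ)))
      (HahnSeries.ofPowerSeries ℤ ℂ 𝓣[fun z => exp (ℓ₂ z)] : LaurentSeries ℂ)) :
    ∃ a b : ℤ, (a ≠ 0 ∨ b ≠ 0) ∧ ∃ c : ℂ,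
      ∀ᶠ z in 𝓝 (0 : ℂ), (a : ℂ) * ℓ₁ z + (b : ℂ) * ℓ₂ z = c := by
  classical
  by_contra H
  haveI : CharZero (LaurentSeries ℂ) := charZero_of_injective_algebraMap (algebraMap ℂ (LaurentSeries ℂ)).injective
  obtain ⟨D, hD⟩ := exists_algDerivation_eq_derivative
  set L₁ : (LaurentSeries ℂ) := HahnSeries.ofPowerSeries ℤ ℂ 𝓣[ℓ₁] with hL₁
  set L₂ : (LaurentSeries ℂ) := HahnSeries.ofPowerSeries ℤ ℂ 𝓣[ℓ₂] with hL₂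
  set E₁ : (LaurentSeries ℂ) := HahnSeries.ofPowerSeries ℤ ℂ 𝓣[fun z => exp (ℓ₁ z)] with hE₁
  set E₂ : (LaurentSeries ℂ) := HahnSeries.ofPowerSeries ℤ ℂ 𝓣[fun z => exp (ℓ₂ z)] with hE₂
  set y : Fin 2 → (LaurentSeries ℂ) := ![L₁, L₂] with hy
  set z : Fin 2 → (LaurentSeries ℂ) := ![E₁, E₂] with hz
  set Dv : Fin 1 → @Derivation ℂ (LaurentSeries ℂ) (LaurentSeries ℂ) _ _ _ _ _ Algebra.toModule :=
    fun _ => D with hDv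
  -- constants of `d/dX` are `ℂ`
  have hC : ∀ x : (LaurentSeries ℂ), (∀ j, Dv j x = 0) → x ∈ Set.range (algebraMap ℂ (LaurentSeries ℂ)) := fun x hx =>
    (derivative_eq_zero_iff_mem_range_algebraMap x).1 (by rw [← hD]; exact hx 0)
  -- the exponential relations
  have hzne : ∀ i, z i ≠ 0 := by
    intro i; fin_cases i
    · exact ofPowerSeries_taylor_exp_ne_zero ℓ₁
    · exact ofPowerSeries_taylor_exp_ne_zero ℓ₂
  have hexp : ∀ j i, Dv j (z i) = z i * Dv j (y i) := by
    intro j i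
    fin_cases i
    · simp only [hDv, hD]; exact derivative_taylor_exp h₁
    · simp only [hDv, hD]; exact derivative_taylor_exp h₂
  -- integer combinations with constant derivative are constant near `0`
  have hcomb : ∀ q : Fin 2 → ℤ, D (∑ i, (q i : (LaurentSeries ℂ)) * y i) = 0 →
      ∃ c : ℂ, ∀ᶠ w in 𝓝 (0 : ℂ), (q 0 : ℂ) * ℓ₁ w + (q 1 : ℂ) * ℓ₂ w = c := by
    intro q hq
    have hsum : (∑ i, (q i : (LaurentSeries ℂ)) * y i) =
        HahnSeries.ofPowerSeries ℤ ℂ 𝓣[fun w => (q 0 : ℂ) * ℓ₁ w + (q 1 : ℂ) * ℓ₂ w] := by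
      have han₁ : AnalyticAt ℂ (fun w => (q 0 : ℂ) * ℓ₁ w) 0 := analyticAt_const.mul h₁
      have han₂ : AnalyticAt ℂ (fun w => (q 1 : ℂ) * ℓ₂ w) 0 := analyticAt_const.mul h₂
      have hadd := taylor_add han₁ han₂
      have hfun : ((fun w => (q 0 : ℂ) * ℓ₁ w) + fun w => (q 1 : ℂ) * ℓ₂ w) =
          fun w => (q 0 : ℂ) * ℓ₁ w + (q 1 : ℂ) * ℓ₂ w := by
        funext w; rfl
      rw [hfun] at hadd
      rw [hadd, taylor_const_mul, taylor_const_mul, map_add, map_mul, map_mul, ofPowerSeries_C,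
        ofPowerSeries_C, Fin.sum_univ_two]
      simp only [hy, Matrix.cons_val_zero, Matrix.cons_val_one]
      rw [← map_intCast (HahnSeries.C : ℂ →+* (LaurentSeries ℂ)) (q 0), ← map_intCast (HahnSeries.C : ℂ →+* (LaurentSeries ℂ)) (q 1)]
    rw [hsum, hD, derivative_eq_zero_iff_mem_range_algebraMap] at hq
    obtain ⟨c, hc⟩ := hq
    rw [algebraMap_eq_ofPowerSeries_C] at hc
    have hc' := ofPowerSeries_injective hc
    rw [← taylor_const] at hc'
    refine ⟨c, ?_⟩
    have han : AnalyticAt ℂ (fun w => (q 0 : ℂ) * ℓ₁ w + (q 1 : ℂ) * ℓ₂ w) 0 :=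
      (analyticAt_const.mul h₁).add (analyticAt_const.mul h₂)
    exact (eventuallyEq_of_taylor_eq analyticAt_const han hc').symm.mono fun w hw => hw
  have hind : ∀ q : Fin 2 → ℤ, (∀ j, Dv j (∑ i, (q i : (LaurentSeries ℂ)) * y i) = 0) → q = 0 := by
    intro q hq
    obtain ⟨c, hc⟩ := hcomb q (hq 0)
    by_contra hq0
    have hne : q 0 ≠ 0 ∨ q 1 ≠ 0 := by
      by_contra h'
      push Not at h'
      apply hq0
      funext i; fin_cases i
      · exact h'.1
      · exact h'.2
    exact H ⟨q 0, q 1, hne, c, hc⟩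
  -- `D L₁ ≠ 0`, so the rank term is `≥ 1`
  have hDL₁ : D L₁ ≠ 0 := by
    intro h0
    obtain ⟨c, hc⟩ := hcomb ![1, 0] (by
      have : (∑ i, ((![(1 : ℤ), 0] i : ℤ) : (LaurentSeries ℂ)) * y i) = L₁ := by
        simp only [Fin.sum_univ_two, hy, Matrix.cons_val_zero, Matrix.cons_val_one]
        push_cast; ring
      rw [this]; exact h0)
    refine H ⟨1, 0, Or.inl one_ne_zero, c, ?_⟩
    simpa using hc
  have hrank : 1 ≤ (Matrix.of fun i j => Dv j (y i)).rank := by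
    rw [Matrix.rank]
    by_contra hlt
    push Not at hlt
    have hbot : LinearMap.range (Matrix.of fun i j => Dv j (y i)).mulVecLin = ⊥ :=
      Submodule.finrank_eq_zero.1 (Nat.lt_one_iff.1 hlt)
    have hmem : (Matrix.of fun i j => Dv j (y i)).mulVecLin (Pi.single 0 1) ∈
        LinearMap.range (Matrix.of fun i j => Dv j (y i)).mulVecLin := LinearMap.mem_range_self _ _
    rw [hbot, Submodule.mem_bot, Matrix.mulVecLin_apply, Matrix.mulVec_single_one] at hmem
    have := congrFun hmem 0
    simp only [Matrix.col_apply, Matrix.of_apply, Pi.zero_apply, hDv, hy,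
      Matrix.cons_val_zero] at this
    exact hDL₁ this
  -- Ax: `3 ≤ trdeg`
  have hax := Ax1971.add_rank_le_trdeg_of_field (k := ℂ) (K := LaurentSeries ℂ) (m := 1) (n := 2)
    Dv hC y z hzne hexp hind
  have h3 : (3 : Cardinal) ≤ Algebra.trdeg ℂ (Algebra.adjoin ℂ (Set.range y ∪ Set.range z)) := by
    refine le_trans ?_ hax
    have : (3 : ℕ) ≤ 2 + (Matrix.of fun i j => Dv j (y i)).rank := by omega
    exact_mod_cast this
  -- but everything is algebraic over `ℂ[s]`, `#s ≤ 2`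
  haveI : IsDomain (Algebra.adjoin ℂ (s : Set (LaurentSeries ℂ))) := inferInstance
  have hgen : Set.range y ∪ Set.range z ⊆
      ((Subalgebra.algebraicClosure (Algebra.adjoin ℂ (s : Set (LaurentSeries ℂ))) (LaurentSeries ℂ)).restrictScalars ℂ :
        Subalgebra ℂ (LaurentSeries ℂ)) := by
    rintro u (⟨i, rfl⟩ | ⟨i, rfl⟩)
    · fin_cases i
      · exact ha₁
      · exact ha₂
    · fin_cases i
      · exact ha₃
      · exact ha₄
  have hle := Algebra.adjoin_le hgen
  have halg : ∀ a ∈ Algebra.adjoin ℂ (Set.range y ∪ Set.range z),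
      IsAlgebraic (Algebra.adjoin ℂ (s : Set (LaurentSeries ℂ))) a := fun a ha => hle ha
  have h2 := trdeg_le_card_of_forall_isAlgebraic (Algebra.adjoin ℂ (Set.range y ∪ Set.range z)) s halg
  have : (3 : Cardinal) ≤ (2 : ℕ) := (h3.trans h2).trans (by exact_mod_cast hs)
  norm_num at this

end AxTwoGerms

end Literature.NumberTheory.Transcendental

end
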